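import Mathlib
import HarnessLib

/-!
# ValiantsHypothesis / LacunarySymmetroid — crux `MatrixDescartes` (stmt-ValiantsHypothesis-18050, V1),
# line `Cruxes/MatrixDescartes/Lines/osculation_law.lean` («osculation-law»), stub `stub_peel` (ALL ranks):
# AN ESCAPING BRANCH ENDS AT A ZERO OF THE TOP COEFFICIENT (rank-free; the "ESCAPE end" of piece (α) of
# NOTE-p7g12-peel-general-r-sizing.md)

Coefficient language (Mathlib only): `P : ℝ → ℝ[X]` a family of degree `≤ r` whose coefficients are continuous at `ω`;
if a solution `β` of `(P t)(β t) = 0` on `(α, ω)` escapes, `β → +∞` as `t → ω⁻`, then the top coefficient vanishes at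
`ω`: `(P ω).coeff r = 0` (divide `Σ_k a_k(t) β^k = 0` by `β^r` and let `t → ω⁻`).  For the block pencils of the line,
`a_r = lowerDet` (p5 g11's `OsculationLetter.coeff_top`), so ESCAPE ends are charged to `Z₊mult(lowerDet)`; the twin
statement "a branch tending to `0` ends at a zero of `a_0 = blockDet`" is `OsculationPeel.eval_eq_zero_of_tendsto` with
`b* = 0` (`…PeelExtend`).

* `tendsto_pow_div_pow_atTop` — `β^k/β^r → 0` along `β → +∞` for `k < r`.
* **`coeff_eq_zero_of_tendsto_atTop`** — the statement above; `coeff_eq_zero_of_tendsto_atTop_left` — at the left end.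

Honest framing: a rank-free LEMMA toward the OPEN stub `stub_peel` (all `r`); nothing of the summit is proved; `VP ≠ VNP` is
NOT proved.  No definitions, no named facts.
-/

-- `Summit.ValiantsHypothesis.ValiantsHypothesis.…` is the tree's mandated single-conjunct layout (Sub = Summit).
set_option linter.dupNamespace false

noncomputable section

namespace Summit.ValiantsHypothesis.ValiantsHypothesis.Theorems.LacunarySymmetroidMatrixDescartes

open Polynomial Set Filter
open scoped BigOperators Topology

namespace OsculationPeel

/-- `β^k / β^r → 0` when `β → +∞` and `k < r`. [folklore] -/
theorem tendsto_pow_div_pow_atTop {ι : Type*} {l : Filter ι} {β : ι → ℝ} (hβ : Tendsto β l atTop) {k r : ℕ}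
    (hk : k < r) : Tendsto (fun i => β i ^ k / β i ^ r) l (𝓝 0) := by
  have hpos : ∀ᶠ i in l, 0 < β i := hβ.eventually (eventually_gt_atTop 0)
  have h1 : Tendsto (fun i => (β i ^ (r - k))⁻¹) l (𝓝 0) :=
    tendsto_inv_atTop_zero.comp (tendsto_pow_atTop (by omega) |>.comp hβ)
  refine h1.congr' (hpos.mono fun i hi => ?_)
  have hne : β i ≠ 0 := hi.ne'
  rw [eq_div_iff (pow_ne_zero _ hne), ← pow_sub_mul_pow (β i) hk.le]
  field_simp

/-- **An escaping branch ends at a zero of the top coefficient.** [folklore] -/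
theorem coeff_eq_zero_of_tendsto_atTop (P : ℝ → ℝ[X]) (r : ℕ) {α ω : ℝ} {β : ℝ → ℝ} (hαω : α < ω)
    (hdeg : ∀ t, (P t).natDegree ≤ r) (hcoef : ∀ k, ContinuousAt (fun t => (P t).coeff k) ω)
    (hsol : ∀ t ∈ Ioo α ω, (P t).IsRoot (β t)) (hlim : Tendsto β (𝓝[<] ω) atTop) :
    (P ω).coeff r = 0 := by
  -- `F t = Σ_{k ≤ r} a_k(t) β^k / β^r` vanishes on `(α, ω)` where `β > 0` …
  set F : ℝ → ℝ := fun t => ∑ k ∈ Finset.range (r + 1), (P t).coeff k * (β t ^ k / β t ^ r) with hF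
  have hpos : ∀ᶠ t in 𝓝[<] ω, 0 < β t := hlim.eventually (eventually_gt_atTop 0)
  have hmem : ∀ᶠ t in 𝓝[<] ω, t ∈ Ioo α ω := Ioo_mem_nhdsLT hαω
  have hF0 : ∀ᶠ t in 𝓝[<] ω, F t = 0 := by
    filter_upwards [hpos, hmem] with t ht htI
    have hev : (P t).eval (β t) = ∑ k ∈ Finset.range (r + 1), (P t).coeff k * β t ^ k :=
      eval_eq_sum_range' (Nat.lt_succ_of_le (hdeg t)) (β t)
    have hroot : (P t).eval (β t) = 0 := hsol t htI
    have : F t = (P t).eval (β t) / β t ^ r := by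
      rw [hev, hF, Finset.sum_div]
      refine Finset.sum_congr rfl fun k _ => ?_
      ring
    rw [this, hroot, zero_div]
  -- … and tends to `a_r(ω)` as `t → ω⁻`
  have hcoef' : ∀ k, Tendsto (fun t => (P t).coeff k) (𝓝[<] ω) (𝓝 ((P ω).coeff k)) :=
    fun k => (hcoef k).tendsto.mono_left nhdsWithin_le_nhds
  have hterm : ∀ k ∈ Finset.range (r + 1), Tendsto (fun t => (P t).coeff k * (β t ^ k / β t ^ r)) (𝓝[<] ω)
      (𝓝 (if k = r then (P ω).coeff r else 0)) := by
    intro k hk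
    rcases eq_or_ne k r with rfl | hne
    · rw [if_pos rfl]
      refine ((hcoef' k).mul_const 1).congr' ?_ |>.trans (by rw [mul_one])
      filter_upwards [hpos] with t ht
      rw [div_self (pow_ne_zero _ ht.ne')]
    · rw [if_neg hne]
      have hk' : k < r := lt_of_le_of_ne (Nat.lt_succ_iff.1 (Finset.mem_range.1 hk)) hne
      simpa using (hcoef' k).mul (tendsto_pow_div_pow_atTop hlim hk')
  have hsum := tendsto_finsetSum (Finset.range (r + 1)) hterm
  rw [Finset.sum_ite_eq' (Finset.range (r + 1)) r, if_pos (Finset.self_mem_range_succ r)] at hsum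
  have h0 : Tendsto F (𝓝[<] ω) (𝓝 0) := tendsto_const_nhds.congr' (hF0.mono fun t ht => ht.symm)
  exact tendsto_nhds_unique hsum h0

/-- The same at the LEFT end `α` (`β → +∞` as `t → α⁺`). [folklore] -/
theorem coeff_eq_zero_of_tendsto_atTop_left (P : ℝ → ℝ[X]) (r : ℕ) {α ω : ℝ} {β : ℝ → ℝ} (hαω : α < ω)
    (hdeg : ∀ t, (P t).natDegree ≤ r) (hcoef : ∀ k, ContinuousAt (fun t => (P t).coeff k) α)
    (hsol : ∀ t ∈ Ioo α ω, (P t).IsRoot (β t)) (hlim : Tendsto β (𝓝[>] α) atTop) :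
    (P α).coeff r = 0 := by
  set F : ℝ → ℝ := fun t => ∑ k ∈ Finset.range (r + 1), (P t).coeff k * (β t ^ k / β t ^ r) with hF
  have hpos : ∀ᶠ t in 𝓝[>] α, 0 < β t := hlim.eventually (eventually_gt_atTop 0)
  have hmem : ∀ᶠ t in 𝓝[>] α, t ∈ Ioo α ω := Ioo_mem_nhdsGT hαω
  have hF0 : ∀ᶠ t in 𝓝[>] α, F t = 0 := by
    filter_upwards [hpos, hmem] with t ht htI
    have hev : (P t).eval (β t) = ∑ k ∈ Finset.range (r + 1), (P t).coeff k * β t ^ k :=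
      eval_eq_sum_range' (Nat.lt_succ_of_le (hdeg t)) (β t)
    have hroot : (P t).eval (β t) = 0 := hsol t htI
    have : F t = (P t).eval (β t) / β t ^ r := by
      rw [hev, hF, Finset.sum_div]
      refine Finset.sum_congr rfl fun k _ => ?_
      ring
    rw [this, hroot, zero_div]
  have hcoef' : ∀ k, Tendsto (fun t => (P t).coeff k) (𝓝[>] α) (𝓝 ((P α).coeff k)) :=
    fun k => (hcoef k).tendsto.mono_left nhdsWithin_le_nhds
  have hterm : ∀ k ∈ Finset.range (r + 1), Tendsto (fun t => (P t).coeff k * (β t ^ k / β t ^ r)) (𝓝[>] α)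
      (𝓝 (if k = r then (P α).coeff r else 0)) := by
    intro k hk
    rcases eq_or_ne k r with rfl | hne
    · rw [if_pos rfl]
      refine ((hcoef' k).mul_const 1).congr' ?_ |>.trans (by rw [mul_one])
      filter_upwards [hpos] with t ht
      rw [div_self (pow_ne_zero _ ht.ne')]
    · rw [if_neg hne]
      have hk' : k < r := lt_of_le_of_ne (Nat.lt_succ_iff.1 (Finset.mem_range.1 hk)) hne
      simpa using (hcoef' k).mul (tendsto_pow_div_pow_atTop hlim hk')
  have hsum := tendsto_finsetSum (Finset.range (r + 1)) hterm
  rw [Finset.sum_ite_eq' (Finset.range (r + 1)) r, if_pos (Finset.self_mem_range_succ r)] at hsum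
  have h0 : Tendsto F (𝓝[>] α) (𝓝 0) := tendsto_const_nhds.congr' (hF0.mono fun t ht => ht.symm)
  exact tendsto_nhds_unique hsum h0

end OsculationPeel

end Summit.ValiantsHypothesis.ValiantsHypothesis.Theorems.LacunarySymmetroidMatrixDescartes

end
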